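import Summits.QuantumFields.BalabanUV.Beta.EriceRemainderEnclosureHistoryAutonomyComparisonAgeCompositionKeyFree
import Summits.QuantumFields.BalabanUV.Beta.EriceRemainderEnclosureHistoryAutonomyComparisonAgeCompositionBVStabilityFlow

/-!
# EriceRemainderEnclosureHistoryAutonomyComparisonAgeCompositionWeightedVariation — (E115g) route (N), first order, ABSTRACT: THE RELATIVE FORM OF THE KEY-FREE
# COMPOSITION BOUND.  (E115c) bounds the Neumann remainder `S_y S_O g` (`g = R_O R_y ε`) by the TOTAL variation of `g` — an ABSOLUTE quantity, too crude when the
# old surplus `v = S_O e` is small at the pin (many loaded old ages: `v(n) ≈ e^{−T_O}`), because it forgets that the old system answers a slowly varying input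
# in proportion to ITS OWN surplus (README `HOME/b2b-balaban-beta-d4-p2/g96/README.md` §3∕§6).  Here: (i) under the END at every truncation the solution is
# controlled by the variation of the input WEIGHTED BY THE INDICATOR SOLUTIONS: `|S f n| ≤ Σ_{J≥n} |f J − f (J+1)|·S 1_{[0,J]} n` (**`abs_sol_le_weighted_var`**;
# exact Abel decomposition (E115a)) — steps of `f` far below the pin are damped by the old END value for that truncation; (ii) a light young system is
# LOCALLY sup-stable: `|S_y u n| ≤ (sup_{[n,b)} |u| + ρ^D·sup_{≥b} |u|)∕(1−ρ)` for `b = n + D·k` (**`abs_sol_le_local_sup`**; (E115c) sup-stability + (E115a)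
# locality); hence (iii) **`sol_ge_first_sub_weighted`**:
#   `ε n ≥ S_y(S_O e) n − ( max_{m∈[n,b)} Σ_{J≥m} |g J − g (J+1)|·S_O 1_{[0,J]} m + ρ^D·Var_{≥b} g ) ∕ (1 − ρ)`
# — the remainder through the old END PROFILE IN THE TRUNCATION near the pin plus a geometric far field.  What the flow must supply (open, README §6 (1′)):
# the truncation profile `J ↦ S_O 1_{[0,J]}(m)` for `m` near the pin is `≲ C·S_O 1_{[0,J]}(n)` once `J` is an old window below `m` (numerics kit `g96law4`).

Cell `pub-balaban`, β-function sub-cell, BINDER row D4 «RemainderConst leaves for Bałaban's split» (`HOME/BINDER-OWNERS.md`; owner lineage `b2b-balaban-beta-an4`;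
this file by co-owner #2 lineage `b2b-balaban-beta-d4-p2`, generation 96), β-FLOW TEAM duty (1), FREEZE (0) honoured (def-free; imports (E115c), (E115b); uses
(E115a) `sol_eq_sum_Ico` ∕ `sol_add` ∕ `abs_sol_le_var`, (E115b) `abs_sol_le_pow_of_gap'`, (E115c) `abs_sol_le_sup_div` ∕ `sol_eq_first_add_remainder`, (E71a) `read_eq_zero_of_tail`
BY NAME; pure renewal algebra; nothing restated).

HONEST FRAMING (page 1, verbatim and binding).  *"Discharging BetaPertH makes Bałaban's UV stability UNCONDITIONAL — a real constructive-QFT result; it is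
NOT the continuum limit and NOT the Clay problem."*  THIS FILE DISCHARGES NOTHING OF THE KIND.  Elementary linear algebra about ABSTRACT real sequences and
triangular systems — tools for the cell's own first-order census (route (N) of conjecture (E58′)); the form, signs, ages and moments of Bałaban's (1.22) limit
functional are NOT PRINTED ([I] p. 298; GAPS G-t4-U2-1∕-2) and NOT asserted.  Row D4 class UNCHANGED (critical-path width 0; instance 0∕1; D4 DISCHARGE NO
DATE).  HONEST DEPENDENCY: continuum YM on T⁴ ⇐ BetaPertH ∧ nine spine estimates (0/9 proved); BetaPertH ⇐ (D1) ∧ (D4) ∧ CAP+tail; G-an2-4 gates asym, D1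
and NE2/3/4.

NOT CLAIMED: any flow instance; the truncation-profile bound; the END beyond the tree's classes; anything printed — NOT B12 Thm 2, NOT BetaPertH.

WHAT IS PROVED ([folklore]; 0 `def`, 0 sorry; (E71a)'s conventions).  §1 **`abs_sol_le_weighted_var`**.  §2 **`abs_sol_le_local_sup`**.  §3 **`sol_ge_first_sub_weighted`**.
-/
noncomputable section
open Finset

namespace Summit.QuantumFields.BalabanUV.Beta.EriceRemainderEnclosureHistoryAutonomyComparisonAgeCompositionWeightedVariation

open Summit.QuantumFields.BalabanUV.Beta.EriceRemainderEnclosureHistoryAutonomyComparisonAgeComposition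
open Summit.QuantumFields.BalabanUV.Beta.EriceRemainderEnclosureHistoryAutonomyComparisonAgeCompositionBVStability
open Summit.QuantumFields.BalabanUV.Beta.EriceRemainderEnclosureHistoryAutonomyComparisonAgeCompositionKeyFree
open Summit.QuantumFields.BalabanUV.Beta.EriceRemainderEnclosureHistoryAutonomyComparisonAgeCompositionBVStabilityFlow (abs_sol_le_pow_of_gap')

variable {N : ℕ} {K KO Ky : ℕ → ℕ → ℝ} {R S RO Ry SO Sy : (ℕ → ℝ) → ℕ → ℝ}

/-! ## §1 The solution is controlled by the variation of the input weighted by the indicator solutions -/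

/-- **WEIGHTED BV BOUND.**  Under the END at every truncation (`0 ≤ S 1_{[0,J]}`): `|S f n| ≤ Σ_{n≤J≤N} |f J − f (J+1)|·S 1_{[0,J]} n` for every zero-tailed input —
steps of the input at the truncation depth `J` enter with the weight `S 1_{[0,J]} n`, the END value at `n` for that truncation. [folklore] -/
theorem abs_sol_le_weighted_var (hR : ∀ v n, R v n = ∑ l ∈ range N, K n l * v (n + 1 + l))
    (hS : ∀ w : ℕ → ℝ, (∀ n, N < n → w n = 0) → (∀ n, N < n → S w n = 0) ∧ ∀ n, S w n = w n - R (S w) n)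
    (hEND0 : ∀ J n, J ≤ N → 0 ≤ S (fun m => if m ≤ J then (1 : ℝ) else 0) n)
    {f : ℕ → ℝ} (hf : ∀ n, N < n → f n = 0) (n : ℕ) :
    |S f n| ≤ ∑ J ∈ Ico n (N + 1), |f J - f (J + 1)| * S (fun m => if m ≤ J then (1 : ℝ) else 0) n := by
  by_cases hn : n ≤ N + 1
  · rw [sol_eq_sum_Ico hR hS hf hn]
    refine (abs_sum_le_sum_abs _ _).trans (sum_le_sum fun J hJ => ?_)
    have hJN : J ≤ N := by have := (mem_Ico.mp hJ).2; omega
    rw [abs_mul, abs_of_nonneg (hEND0 J n hJN)]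
  · rw [(hS f hf).1 n (by omega), abs_zero]
    exact sum_nonneg fun J hJ => mul_nonneg (abs_nonneg _) (hEND0 J n (by have := (mem_Ico.mp hJ).2; omega))

/-! ## §2 Local sup-stability of a light system of finite range -/

/-- **LOCAL SUP-STABILITY.**  Non-negative kernel with row sums `≤ ρ < 1` at the depths `≥ n`, reading only the lags `< k` (`k ≥ 1`); `b = n + D·k`; a zero-tailed
input `u` with `|u m| ≤ M₁` on `[n, b)` and `|u m| ≤ M₂` for `m ≥ b`.  Then `|S u n| ≤ (M₁ + ρ^D·M₂)∕(1−ρ)`: the near field at full strength, the far field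
through `D` young windows. [folklore] -/
theorem abs_sol_le_local_sup (hR : ∀ v n, R v n = ∑ l ∈ range N, K n l * v (n + 1 + l))
    (hS : ∀ w : ℕ → ℝ, (∀ n, N < n → w n = 0) → (∀ n, N < n → S w n = 0) ∧ ∀ n, S w n = w n - R (S w) n)
    (hK : ∀ n l, 0 ≤ K n l) {n : ℕ} {ρ : ℝ} (hrow : ∀ m, n ≤ m → ∑ l ∈ range N, K m l ≤ ρ) (hρ1 : ρ < 1)
    {k : ℕ} (hk : 1 ≤ k) (hKk : ∀ m l, k ≤ l → K m l = 0) (D : ℕ)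
    {u : ℕ → ℝ} (hut : ∀ m, N < m → u m = 0) {M₁ M₂ : ℝ} (hM₁ : ∀ m, n ≤ m → m < n + D * k → |u m| ≤ M₁) (hM₂ : ∀ m, n + D * k ≤ m → |u m| ≤ M₂)
    (hM₁0 : 0 ≤ M₁) :
    |S u n| ≤ (M₁ + ρ ^ D * M₂) / (1 - ρ) := by
  set b := n + D * k with hb
  have hρ0 : 0 ≤ ρ := (sum_nonneg fun l _ => hK n l).trans (hrow n le_rfl)
  -- split the input at b
  set u₁ : ℕ → ℝ := fun m => if m < b then u m else 0 with hu₁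
  set u₂ : ℕ → ℝ := fun m => if m < b then 0 else u m with hu₂
  have hu₁t : ∀ m, N < m → u₁ m = 0 := fun m hm => by simp only [hu₁, hut m hm, ite_self]
  have hu₂t : ∀ m, N < m → u₂ m = 0 := fun m hm => by simp only [hu₂, hut m hm, ite_self]
  have hsplit : S u n = S u₁ n + S u₂ n := by
    rw [← sol_add hR hS hu₁t hu₂t]
    exact congrArg (fun g => S g n) (funext fun m => by simp only [hu₁, hu₂]; split_ifs <;> simp)
  -- near part: sup-stability from n with the bound M₁ (u₁ vanishes beyond b)
  have h1 : |S u₁ n| ≤ M₁ / (1 - ρ) := by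
    refine abs_sol_le_sup_div hR hK hrow hρ1 (hS u₁ hu₁t).1 (hS u₁ hu₁t).2 (fun m hm => ?_) n le_rfl
    simp only [hu₁]; split_ifs with hmb
    · exact hM₁ m hm hmb
    · rw [abs_zero]; exact hM₁0
  -- far part: sup-stability from b, then locality across D windows
  have h2far : ∀ m, b ≤ m → |S u₂ m| ≤ M₂ / (1 - ρ) := by
    refine abs_sol_le_sup_div hR hK (fun m hm => hrow m (by omega)) hρ1 (hS u₂ hu₂t).1 (hS u₂ hu₂t).2 (fun m hm => ?_)
    simp only [hu₂]; rw [if_neg (by omega)]; exact hM₂ m hm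
  have hw2 : ∀ m, n ≤ m → m < b → u₂ m = 0 := fun m _ hm => by simp only [hu₂, if_pos hm]
  have h2 := abs_sol_le_pow_of_gap' hR hK hrow hρ1.le hk hKk hw2 (hS u₂ hu₂t).2 h2far D n le_rfl le_rfl
  rw [hsplit]
  have h3 := abs_add_le (S u₁ n) (S u₂ n)
  have e : (M₁ + ρ ^ D * M₂) / (1 - ρ) = M₁ / (1 - ρ) + ρ ^ D * (M₂ / (1 - ρ)) := by ring
  rw [e]; linarith

/-! ## §3 The relative form of the KEY-free composition bound -/

/-- **THE KEY-FREE COMPOSITION BOUND, WEIGHTED FORM.**  Old kernel with the END at every truncation; young kernel `≥ 0` with row sums `≤ ρ < 1` below the pin,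
lags `< k` (`k ≥ 1`); `ε` the zero-tailed full surplus of the zero-tailed excess `e`; `g = R_O (R_y ε)`; `b = n + D·k`; `W` a bound for the WEIGHTED tail
variations of `g` near the pin, `Σ_{J≥m} |g J − g (J+1)|·S_O 1_{[0,J]} m ≤ W` for `m ∈ [n, b)`.  Then
`ε n ≥ S_y(S_O e) n − (W + ρ^D·Σ_{J≥n} |g J − g (J+1)|) ∕ (1 − ρ)`. [folklore] -/
theorem sol_ge_first_sub_weighted
    (hRO : ∀ v n, RO v n = ∑ l ∈ range N, KO n l * v (n + 1 + l))
    (hRy : ∀ v n, Ry v n = ∑ l ∈ range N, Ky n l * v (n + 1 + l)) (hKy : ∀ n l, 0 ≤ Ky n l)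
    (hSO : ∀ w : ℕ → ℝ, (∀ n, N < n → w n = 0) → (∀ n, N < n → SO w n = 0) ∧ ∀ n, SO w n = w n - RO (SO w) n)
    (hSy : ∀ w : ℕ → ℝ, (∀ n, N < n → w n = 0) → (∀ n, N < n → Sy w n = 0) ∧ ∀ n, Sy w n = w n - Ry (Sy w) n)
    (hENDO : ∀ J n, J ≤ N → 0 ≤ SO (fun m => if m ≤ J then (1 : ℝ) else 0) n ∧ SO (fun m => if m ≤ J then (1 : ℝ) else 0) n ≤ 1)
    {n : ℕ} {ρ : ℝ} (hrow : ∀ m, n ≤ m → ∑ l ∈ range N, Ky m l ≤ ρ) (hρ1 : ρ < 1)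
    {k : ℕ} (hk : 1 ≤ k) (hKyk : ∀ m l, k ≤ l → Ky m l = 0) (D : ℕ)
    {e : ℕ → ℝ} (he : ∀ n, N < n → e n = 0)
    {ε : ℕ → ℝ} (hεtail : ∀ n, N < n → ε n = 0) (hεrec : ∀ n, ε n = e n - RO ε n - Ry ε n)
    {W : ℝ} (hW0 : 0 ≤ W)
    (hW : ∀ m, n ≤ m → m < n + D * k →
      ∑ J ∈ Ico m (N + 1), |RO (Ry ε) J - RO (Ry ε) (J + 1)| * SO (fun m => if m ≤ J then (1 : ℝ) else 0) m ≤ W) :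
    Sy (SO e) n - (W + ρ ^ D * ∑ J ∈ Ico n (N + 1), |RO (Ry ε) J - RO (Ry ε) (J + 1)|) / (1 - ρ) ≤ ε n := by
  have hRyt : ∀ m, N < m → Ry ε m = 0 := fun m hm =>
    read_eq_zero_of_tail (c := 0) hRy (fun j hj => hεtail j (by simpa using hj)) m (by omega)
  have hgt : ∀ m, N < m → RO (Ry ε) m = 0 := fun m hm =>
    read_eq_zero_of_tail (c := 0) hRO (fun j hj => hRyt j (by simpa using hj)) m (by omega)
  rw [sol_eq_first_add_remainder hRO hRy hSO hSy he hεtail hεrec n]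
  set g := RO (Ry ε) with hg
  set V : ℝ := ∑ J ∈ Ico n (N + 1), |g J - g (J + 1)| with hV
  have hV0 : 0 ≤ V := sum_nonneg fun _ _ => abs_nonneg _
  -- near field: weighted BV; far field: plain BV
  have hM₁ : ∀ m, n ≤ m → m < n + D * k → |SO g m| ≤ W := fun m hm hmb =>
    (abs_sol_le_weighted_var hRO hSO (fun J m hJ => (hENDO J m hJ).1) hgt m).trans (hW m hm hmb)
  have hM₂ : ∀ m, n + D * k ≤ m → |SO g m| ≤ V := fun m hm => by
    refine (abs_sol_le_var hRO hSO hENDO hgt m).trans ?_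
    exact sum_le_sum_of_subset_of_nonneg (Ico_subset_Ico (by omega) le_rfl) fun _ _ _ => abs_nonneg _
  have hy := abs_sol_le_local_sup hRy hSy hKy hrow hρ1 hk hKyk D (hSO g hgt).1 hM₁ hM₂ hW0
  have := neg_abs_le (Sy (SO g) n)
  linarith

end Summit.QuantumFields.BalabanUV.Beta.EriceRemainderEnclosureHistoryAutonomyComparisonAgeCompositionWeightedVariation

end
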